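import Literature.Computability.Complexity.SearchToDecision
import Literature.Computability.Complexity.Oracle
import HarnessLib

/-!
# Total NP search problems: `FNP`, `TFNP`, solvability in `FP`, reductions between search problems

Vocabulary of the theory of total search problems (Megiddo–Papadimitriou 1991; Papadimitriou
1994; in the modern rendering of Fearnley–Goldberg–Hollender–Savani 2022, §3.1.1 of the arXiv
version) over the tree's string classes `Classes.P`, `FP` and the pairing `⟨x, y⟩ = boolPair x y`
(`BoolEncodings.lean`), so that the routes of `Summits/PneNP` which argue "`X ∉ FP` for a total
search problem `X`, hence `P ≠ NP`" can be stated over one vocabulary.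

* `SearchProblem` — a search problem over `{0,1}`: a set `valid` of instances (the *promise*;
  `Set.univ` for the printed, promise-free notion) and the instance–solution relation `rel`, a
  language of pairs `⟨x, y⟩`; `R.solutions x = {y | ⟨x, y⟩ ∈ R.rel}`.
* `SearchProblem.IsPolyBalanced` (`⟨x, y⟩ ∈ R ⟹ |y| ≤ p(|x|)`), the classes
  `FNP = {R | R.rel ∈ P ∧ R.valid ∈ P ∧ R.IsPolyBalanced}` and `TFNP = {R ∈ FNP | R.IsTotal}`
  (`IsTotal`: every valid instance has a solution), and the bundled form `TotalSearchProblem`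
  (a `SearchProblem` together with the four proofs; `TotalSearchProblem.mem_TFNP`,
  `TotalSearchProblem.ofMemTFNP`).
* `SearchProblem.SolvableInFP R` — some `g ∈ FP` returns a solution on every valid instance
  (Megiddo–Papadimitriou's class `FP` of search problems, as a predicate); `IsSolver`.
* `SearchProblem.ManyOneReducible R S` — polynomial-time many-one reductions between search
  problems: `f ∈ FP` on instances and `g ∈ FP` on pairs ⟨instance, solution⟩ with
  `⟨f x, y⟩ ∈ S ⟹ ⟨x, g ⟨x, y⟩⟩ ∈ R` (Papadimitriou 1994, §2; FGHS 2022, §3.1.1), here in the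
  promise-preserving form "valid instances go to valid instances" (FGMS 2020; FGHS 2022, §3.1.3);
  `refl`, `trans`, and transport of `SolvableInFP` (`SolvableInFP.of_manyOneReducible`).
* `SearchProblem.TuringReducible R S` — polynomial-time Turing reductions: ONE polynomial-time
  oracle algorithm (`OracleAlg`, `Oracle.lean`) solving `R` with every solver of `S` as oracle
  (Buss–Johnson 2012, Def. 2.3–2.4; Beame–Cook–Edmonds–Impagliazzo–Pitassi 1998, §2), querying
  only valid, polynomially long instances of `S`.
* `TFNP.closureOf X = {R ∈ TFNP | R ≤ₘ X}` — the syntactic subclass presented by a problem `X`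
  ("the class of all TFNP problems that reduce to `X`", the form in which `PPAD`, `PLS`, `PPA`,
  `PPP`, `CLS` are defined in `TFNPClasses.lean`); monotone and downward closed.
* **The folklore theorem** `SearchProblem.solvableInFP_of_NP_subset_P`: if `NP ⊆ P` then every
  polynomially balanced search problem with `rel ∈ P` that is total on its valid instances is
  solvable in `FP` ("it is not known whether FP = FNP; this question is equivalent to P = NP",
  Megiddo–Papadimitriou 1991, p. 318) — an immediate consequence of the tree's PROVED
  search-to-decision theorem `exists_searchFn_of_NP_subset_P` (Arora–Barak Thm. 2.18); with the
  contrapositives `not_NP_subset_P_of_not_solvableInFP`, `P_ne_NP_of_not_solvableInFP`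
  (combine with `pneNP_shape_of_P_ne_NP` of `CookBridges.lean` to reach Cook's statement).
## Design notes

* The printed definitions (MP91 p. 317; Pap94 §2; FGHS22 §3.1.1) have no promise: a search
  problem is a relation `R ⊆ {0,1}* × {0,1}*`, total iff `∀ x ∃ y` — the case `valid = Set.univ`
  of ours verbatim. The promise set is carried because (i) the requesting routes quantify over
  valid instance codes, (ii) the canonical complete problems come with syntactic side conditions
  (`P(0ⁿ) = 0ⁿ ≠ S(0ⁿ)`, …) which the literature "enforces syntactically", i.e. treats as a
  `P`-decidable promise, and (iii) promise versions and promise-preserving reductions are standard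
  (FGMS20; FGHS22 §3.1.3). Membership in `FNP`/`TFNP` REQUIRES `valid ∈ P`, and for such a
  promise the promise form and the printed form are many-one equivalent
  (`SearchProblemTotalize.lean`: `R ≤ₘ R.totalize ≤ₘ R`).
* `SolvableInFP R` asks for a solution on every valid instance, so it entails `IsTotal R`
  (`SolvableInFP.isTotal`); for non-total problems MP91's "reply *no* otherwise" is not modelled
  (not needed for TFNP).
* Nothing here is specific to circuits; the canonical problems `END-OF-LINE`,
  `END-OF-POTENTIAL-LINE`, `SINK-OF-DAG`, `ITER`, `LOCALOPT`, `LEAF`, `PIGEON` and the classes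
  `PPAD`, `PLS`, `CLS`, `PPA`, `PPP` are in `TFNPProblems.lean` / `TFNPClasses.lean`.
* Not here: MP91 Thm. 2.1 (an FNP-complete problem in TFNP iff NP = coNP), `TFNP = F(NP ∩ coNP)`,
  Turing-closure classes, the decision-tree (black-box) model `TFNP^dt`.

## References

* N. Megiddo, C. H. Papadimitriou, *On total functions, existence theorems and computational
  complexity*, Theoret. Comput. Sci. 81 (1991) 317–324, pp. 317–318 (R, FNP, FP, total, TFNP),
  §2 p. 322 (reductions, Thm. 2.1).
* C. H. Papadimitriou, *On the complexity of the parity argument and other inefficient proofs of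
  existence*, J. Comput. System Sci. 48 (1994) 498–532, §2 pp. 504–506 (FNP, TFNP, reductions
  `(f, g)`, closure under reductions, Prop. 1).
* J. Fearnley, P. W. Goldberg, A. Hollender, R. Savani, *The complexity of gradient descent:
  CLS = PPAD ∩ PLS*, J. ACM 70 (2022); arXiv:2011.01929 §3.1.1 (search problems, FNP, TFNP,
  reductions), §3.1.2–3.1.3 (syntactic enforcement; promise-preserving reductions).
* J. Fearnley, S. Gordon, R. Mehta, R. Savani, *Unique end of potential line*, J. Comput. System
  Sci. 114 (2020) 1–35; arXiv:1811.03841 §2 (promise versions).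
* S. R. Buss, A. S. Johnson, *Propositional proofs and reductions between NP search problems*,
  Ann. Pure Appl. Logic 163 (2012) 1163–1182, Def. 2.1 (NP search problems, TFNP), Def. 2.3–2.5
  (search problems as oracles; Turing and many-one reductions; the classes `C_m(Q)`, `C_T(Q)`).
* P. Beame, S. Cook, J. Edmonds, R. Impagliazzo, T. Pitassi, *The relative complexity of NP
  search problems*, J. Comput. System Sci. 57 (1998) 3–19, §2 (many-one and Turing reductions
  between search problems; the reference [1] of Buss–Johnson).
* S. Arora, B. Barak, *Computational Complexity: A Modern Approach*, CUP 2009, Thm. 2.18.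
-/

namespace Literature.Computability.Complexity

open _root_.Computability

/-! ### Search problems -/

/-- A **search problem** over `{0,1}` in promise form: a set `valid` of (codes of) instances and
the instance–solution relation `rel`, a language of pairs `⟨x, y⟩ = boolPair x y` ("given `x`,
find `y` with `(x, y) ∈ R`"). The printed notion (a relation `R ⊆ Σ* × Σ*` on all strings) is
the case `valid = Set.univ`; see the module docstring for the promise convention.
[Megiddo–Papadimitriou 1991, p. 317; Papadimitriou 1994, §2 (p. 504); FGHS 2022, §3.1.1]
[cite: MegiddoPapadimitriou1991, p. 317] -/
structure SearchProblem where
  /-- The valid instances (the promise; `Set.univ` for a promise-free problem). -/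
  valid : Language Bool
  /-- The instance–solution relation, a language of pairs `boolPair x y`. -/
  rel : Language Bool

namespace SearchProblem

variable (R S T : SearchProblem)

/-- The solutions of the instance `x`: `R.solutions x = {y | ⟨x, y⟩ ∈ R.rel}`.
[Megiddo–Papadimitriou 1991, p. 318] [cite: MegiddoPapadimitriou1991, p. 318] -/
def solutions (x : List Bool) : Set (List Bool) :=
  {y | boolPair x y ∈ R.rel}

/-- Membership in the solution set (definitional). [folklore] -/
@[simp] theorem mem_solutions (x y : List Bool) : y ∈ R.solutions x ↔ boolPair x y ∈ R.rel :=
  Iff.rfl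

/-- `R` is **polynomially balanced**: `(x, y) ∈ R` implies `|y| ≤ p(|x|)` for some polynomial
`p`. [Megiddo–Papadimitriou 1991, p. 317; Papadimitriou 1994, §2; FGHS 2022, §3.1.1]
[cite: MegiddoPapadimitriou1991, p. 317] -/
def IsPolyBalanced (R : SearchProblem) : Prop :=
  ∃ p : Polynomial ℕ, ∀ x y : List Bool, boolPair x y ∈ R.rel → y.length ≤ p.eval x.length

/-- `R` is **total**: every (valid) instance has a solution, `∀ x ∈ valid, ∃ y, (x, y) ∈ R`.
[Megiddo–Papadimitriou 1991, p. 318 ("R is total if for every x there is a y with (x,y) ∈ R");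
FGHS 2022, §3.1.1] [cite: MegiddoPapadimitriou1991, p. 318] -/
def IsTotal (R : SearchProblem) : Prop :=
  ∀ x ∈ R.valid, ∃ y : List Bool, boolPair x y ∈ R.rel

/-- `R` is **solvable in polynomial time**: some string function `g ∈ FP` returns a solution on
every valid instance, `⟨x, g x⟩ ∈ R.rel` (Megiddo–Papadimitriou's class `FP` of search problems
"that can be solved in polynomial time", as a predicate; for total problems the printed "reply
*no* otherwise" clause is void). [Megiddo–Papadimitriou 1991, p. 318; Papadimitriou 1994, §2
(p. 504); FGHS 2022, §3.1.1] [cite: MegiddoPapadimitriou1991, p. 318] -/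
def SolvableInFP (R : SearchProblem) : Prop :=
  ∃ g ∈ FP, ∀ x ∈ R.valid, boolPair x (g x) ∈ R.rel

/-- `O` is a **solver** (an oracle) for `S`: a total string function returning a solution on
every valid instance (a search problem "used as an oracle": a query `y` is answered by some
`z ∈ Q(y)`). [Buss–Johnson 2012, Def. 2.3; Beame et al. 1998, §2]
[cite: BussJohnson2012, Def. 2.3] -/
def IsSolver (S : SearchProblem) (O : Oracle) : Prop :=
  ∀ x ∈ S.valid, boolPair x (O x) ∈ S.rel

/-- `SolvableInFP` is the existence of a polynomial-time solver. [folklore] -/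
theorem solvableInFP_iff : R.SolvableInFP ↔ ∃ g ∈ FP, R.IsSolver g :=
  Iff.rfl

/-- A problem solvable in `FP` is total (on its valid instances). [Megiddo–Papadimitriou 1991,
p. 318 (`FP ⊆ TFNP`)] [cite: MegiddoPapadimitriou1991, p. 318] -/
theorem SolvableInFP.isTotal {R : SearchProblem} (h : R.SolvableInFP) : R.IsTotal := by
  obtain ⟨g, -, hg⟩ := h
  exact fun x hx => ⟨g x, hg x hx⟩

/-! ### Reductions between search problems -/

/-- **Polynomial-time many-one reduction** of `R` to `S` (`R ≤ₘ S`): polynomial-time `f` (on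
instances) and `g` (on pairs `⟨x, y⟩`) such that for every valid instance `x` of `R`, `f x` is a
valid instance of `S` and every solution `y` of `f x` yields the solution `g ⟨x, y⟩` of `x`:
`⟨f x, y⟩ ∈ S.rel → ⟨x, g ⟨x, y⟩⟩ ∈ R.rel`. For `valid = univ` this is verbatim the printed
"`(f(x), y) ∈ S ⟹ (x, g(x, y)) ∈ R`"; the clause on valid instances is the promise-preserving
form. [Papadimitriou 1994, §2 (p. 506); FGHS 2022, §3.1.1 (Reductions between TFNP problems)
and §3.1.3; Megiddo–Papadimitriou 1991, §2] [cite: Papadimitriou1994Parity, §2 (p. 506)] -/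
def ManyOneReducible (R S : SearchProblem) : Prop :=
  ∃ f ∈ FP, ∃ g ∈ FP, ∀ x ∈ R.valid,
    f x ∈ S.valid ∧ ∀ y : List Bool, boolPair (f x) y ∈ S.rel → boolPair x (g (boolPair x y)) ∈ R.rel

/-- **Polynomial-time Turing reduction** of `R` to `S` (`R ≤ᵀ S`): ONE polynomial-time oracle
algorithm `M` (interactive transcript model of `Oracle.lean`, output a string) and a polynomial
`q` such that for EVERY solver `O` of `S`, on every valid instance `x` of `R` the run of `M` with
oracle `O` halts within `q |x|` rounds with a solution of `x`, having queried only valid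
instances of `S` of length `≤ q |x|` (so all answers that matter are polynomially bounded when
`S` is polynomially balanced, the adequacy condition of `FPRel`). Printed form: "M outputs some
`z ∈ Q₁(x)` in polynomial time relative to `Q₂`", each query `y` being answered by SOME element
of `Q₂(y)`; quantifying over all solver FUNCTIONS `O` is the same for machines that never repeat
a query (cache the answers), and like the sources the notion is meant for total `S` (for an `S`
without solvers the clause is vacuous). [Buss–Johnson 2012, Def. 2.4 (type-1 case); Beame et
al. 1998, §2 (origin of the notion)] [cite: BussJohnson2012, Def. 2.4] -/
def TuringReducible (R S : SearchProblem) : Prop :=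
  ∃ M : OracleAlg (List Bool), M.IsPolyTime (encodingList Bool) ∧ ∃ q : Polynomial ℕ,
    ∀ O : Oracle, S.IsSolver O → ∀ x ∈ R.valid,
      (∃ y, M.run O (q.eval x.length) x = some y ∧ boolPair x y ∈ R.rel) ∧
        ∀ z ∈ M.queries O (q.eval x.length) x, z ∈ S.valid ∧ z.length ≤ q.eval x.length

/-- Many-one reducibility is reflexive (`f = id`, `g ⟨x, y⟩ = y`, the second projection of the
pairing, `boolUnpairSnd_mem_FP`). [Papadimitriou 1994, §2] [cite: Papadimitriou1994Parity, §2] -/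
protected theorem ManyOneReducible.refl (R : SearchProblem) : R.ManyOneReducible R :=
  ⟨id, PolyTimeComputable.id _, fun z => (boolUnpair z).2, boolUnpairSnd_mem_FP, fun x hx =>
    ⟨hx, fun y hy => by simpa only [boolUnpair_boolPair, id] using hy⟩⟩

/-- Many-one reducibility is transitive: instances by `f' ∘ f`, solutions by
`⟨x, y⟩ ↦ g ⟨x, g' ⟨f x, y⟩⟩` (assembled from the pair projections and the fan-out
`fanoutFn`, all in `FP`). [Papadimitriou 1994, §2; FGHS 2022, §3.1.1]
[cite: Papadimitriou1994Parity, §2] -/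
theorem ManyOneReducible.trans {R S T : SearchProblem} (h₁ : R.ManyOneReducible S)
    (h₂ : S.ManyOneReducible T) : R.ManyOneReducible T := by
  obtain ⟨f, hf, g, hg, h⟩ := h₁
  obtain ⟨f', hf', g', hg', h'⟩ := h₂
  refine ⟨f' ∘ f, comp_mem_FP hf' hf,
    g ∘ fanoutFn (fun z => (boolUnpair z).1)
      (g' ∘ fanoutFn (f ∘ fun z => (boolUnpair z).1) (fun z => (boolUnpair z).2)),
    comp_mem_FP hg (fanoutFn_mem_FP boolUnpairFst_mem_FP (comp_mem_FP hg'
      (fanoutFn_mem_FP (comp_mem_FP hf boolUnpairFst_mem_FP) boolUnpairSnd_mem_FP))),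
    fun x hx => ?_⟩
  obtain ⟨hfx, hsol⟩ := h x hx
  obtain ⟨hffx, hsol'⟩ := h' (f x) hfx
  refine ⟨hffx, fun y hy => ?_⟩
  simpa only [Function.comp_apply, fanoutFn_apply, boolUnpair_boolPair] using hsol _ (hsol' y hy)

/-- **Solvability in `FP` descends along many-one reductions**: if `R ≤ₘ S` and `S` is solvable
in polynomial time then so is `R` (solve `f x`, pull the solution back with `g`). [FGHS 2022,
§3.1.1 ("if S is polynomial-time solvable, then so is R"); Papadimitriou 1994, §2, Prop. 1]
[cite: FearnleyGoldbergHollenderSavani2022, §3.1.1] -/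
theorem SolvableInFP.of_manyOneReducible {R S : SearchProblem} (h : R.ManyOneReducible S)
    (hS : S.SolvableInFP) : R.SolvableInFP := by
  obtain ⟨f, hf, g, hg, h⟩ := h
  obtain ⟨s, hs, hsol⟩ := hS
  refine ⟨g ∘ fanoutFn id (s ∘ f), comp_mem_FP hg (fanoutFn_mem_FP (PolyTimeComputable.id _) (comp_mem_FP hs hf)),
    fun x hx => ?_⟩
  obtain ⟨hfx, hback⟩ := h x hx
  simpa only [Function.comp_apply, fanoutFn_apply, id] using hback _ (hsol _ hfx)

/-- A solver of `S` pulls back along a many-one reduction to a solver of `R` (pointwise form of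
`SolvableInFP.of_manyOneReducible`, for arbitrary oracles: a many-one reduction is a one-query
Turing reduction). [Buss–Johnson 2012, Def. 2.4 ("if M makes at most one query to Q₂, then M is
a many-one reduction")] [cite: BussJohnson2012, Def. 2.4] -/
theorem ManyOneReducible.isSolver_comp {R S : SearchProblem} {f g : List Bool → List Bool}
    (h : ∀ x ∈ R.valid, f x ∈ S.valid ∧
      ∀ y : List Bool, boolPair (f x) y ∈ S.rel → boolPair x (g (boolPair x y)) ∈ R.rel)
    {O : Oracle} (hO : S.IsSolver O) : R.IsSolver fun x => g (boolPair x (O (f x))) :=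
  fun x hx => (h x hx).2 _ (hO _ (h x hx).1)

/-! ### The classes `FNP`, `TFNP`; bundled total search problems -/

/-- **`FNP`**: search problems whose relation is polynomial-time decidable (`rel ∈ P`) and
polynomially balanced, with a polynomial-time decidable promise (`valid ∈ P`; `valid = univ` in
print — see `SearchProblem.totalize` for the equivalence). [Megiddo–Papadimitriou 1991, p. 318;
Papadimitriou 1994, §2; FGHS 2022, §3.1.1] [cite: MegiddoPapadimitriou1991, p. 318] -/
def _root_.Literature.Computability.Complexity.FNP : Set SearchProblem :=
  {R | R.rel ∈ Classes.P ∧ R.valid ∈ Classes.P ∧ R.IsPolyBalanced}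

/-- **`TFNP`** ("total functions from NP"): the problems of `FNP` that are total.
[Megiddo–Papadimitriou 1991, p. 318; Papadimitriou 1994, §2; FGHS 2022, §3.1.1]
[cite: MegiddoPapadimitriou1991, p. 318] -/
def _root_.Literature.Computability.Complexity.TFNP : Set SearchProblem :=
  {R ∈ FNP | R.IsTotal}

/-- Unfolding of membership in `FNP`. [folklore] -/
theorem mem_FNP_iff : R ∈ FNP ↔ R.rel ∈ Classes.P ∧ R.valid ∈ Classes.P ∧ R.IsPolyBalanced :=
  Iff.rfl

/-- Unfolding of membership in `TFNP`. [folklore] -/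
theorem mem_TFNP_iff : R ∈ TFNP ↔ R ∈ FNP ∧ R.IsTotal :=
  Iff.rfl

/-- `TFNP ⊆ FNP`. [Megiddo–Papadimitriou 1991, p. 318] [cite: MegiddoPapadimitriou1991, p. 318] -/
theorem _root_.Literature.Computability.Complexity.TFNP_subset_FNP : TFNP ⊆ FNP :=
  fun _ h => h.1

end SearchProblem

/-- A **total NP search problem**, bundled: a search problem together with the proofs that it
lies in `TFNP` — `valid ∈ P`, `rel ∈ P`, polynomially balanced, total. (`T.toSearchProblem ∈ TFNP`
is `TotalSearchProblem.mem_TFNP`; conversely `TotalSearchProblem.ofMemTFNP`.)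
[Megiddo–Papadimitriou 1991, p. 318 (TFNP); Papadimitriou 1994, §2; FGHS 2022, §3.1.1]
[cite: MegiddoPapadimitriou1991, p. 318] -/
structure TotalSearchProblem extends SearchProblem where
  /-- The promise is polynomial-time decidable. -/
  valid_mem_P : valid ∈ Classes.P
  /-- The relation is polynomial-time decidable. -/
  rel_mem_P : rel ∈ Classes.P
  /-- Solutions are polynomially short. -/
  balanced : toSearchProblem.IsPolyBalanced
  /-- Every valid instance has a solution. -/
  total : toSearchProblem.IsTotal

namespace TotalSearchProblem

/-- A bundled total search problem lies in `TFNP`. [Megiddo–Papadimitriou 1991, p. 318]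
[cite: MegiddoPapadimitriou1991, p. 318] -/
theorem mem_TFNP (T : TotalSearchProblem) : T.toSearchProblem ∈ TFNP :=
  ⟨⟨T.rel_mem_P, T.valid_mem_P, T.balanced⟩, T.total⟩

/-- Bundle a member of `TFNP`. [Megiddo–Papadimitriou 1991, p. 318]
[cite: MegiddoPapadimitriou1991, p. 318] -/
def ofMemTFNP (R : SearchProblem) (h : R ∈ TFNP) : TotalSearchProblem where
  toSearchProblem := R
  valid_mem_P := h.1.2.1
  rel_mem_P := h.1.1
  balanced := h.1.2.2
  total := h.2

/-- `ofMemTFNP` bundles the given problem (definitional). [folklore] -/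
@[simp] theorem toSearchProblem_ofMemTFNP (R : SearchProblem) (h : R ∈ TFNP) :
    (ofMemTFNP R h).toSearchProblem = R :=
  rfl

end TotalSearchProblem

/-! ### Syntactic subclasses: the closure of a problem under many-one reductions -/

/-- **The subclass of `TFNP` presented by `X`**: all `TFNP` problems many-one reducible to `X`
("the class … is defined as the set of all TFNP problems that reduce to the problem …", the form
of the definitions of `PPAD`, `PLS`, `CLS`; Papadimitriou: "PPA is the closure under reductions
of …"). [FGHS 2022, §3.1.2; Papadimitriou 1994, §2 (p. 506)]
[cite: FearnleyGoldbergHollenderSavani2022, §3.1.2] -/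
def TFNP.closureOf (X : SearchProblem) : Set SearchProblem :=
  {R ∈ TFNP | R.ManyOneReducible X}

/-- Unfolding of membership in `TFNP.closureOf X`. [folklore] -/
theorem TFNP.mem_closureOf_iff {X R : SearchProblem} :
    R ∈ TFNP.closureOf X ↔ R ∈ TFNP ∧ R.ManyOneReducible X :=
  Iff.rfl

/-- A syntactic subclass is a subclass of `TFNP`. [Papadimitriou 1994, §2, Prop. 1]
[cite: Papadimitriou1994Parity, §2 Prop. 1] -/
theorem TFNP.closureOf_subset_TFNP (X : SearchProblem) : TFNP.closureOf X ⊆ TFNP :=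
  fun _ h => h.1

/-- The presenting problem lies in its class as soon as it lies in `TFNP`. [Papadimitriou 1994,
§2] [cite: Papadimitriou1994Parity, §2] -/
theorem TFNP.self_mem_closureOf {X : SearchProblem} (hX : X ∈ TFNP) : X ∈ TFNP.closureOf X :=
  ⟨hX, SearchProblem.ManyOneReducible.refl X⟩

/-- Syntactic subclasses are closed downwards under many-one reductions inside `TFNP`.
[Papadimitriou 1994, §2 (closure under reductions)] [cite: Papadimitriou1994Parity, §2] -/
theorem TFNP.mem_closureOf_of_manyOneReducible {X R S : SearchProblem} (hR : R ∈ TFNP)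
    (h : R.ManyOneReducible S) (hS : S ∈ TFNP.closureOf X) : R ∈ TFNP.closureOf X :=
  ⟨hR, h.trans hS.2⟩

/-- Monotonicity: `X ≤ₘ Y` gives `closureOf X ⊆ closureOf Y` (so inter-reducible problems
present the same class). [Papadimitriou 1994, §2] [cite: Papadimitriou1994Parity, §2] -/
theorem TFNP.closureOf_mono {X Y : SearchProblem} (h : X.ManyOneReducible Y) :
    TFNP.closureOf X ⊆ TFNP.closureOf Y :=
  fun _ hR => ⟨hR.1, hR.2.trans h⟩

/-- Every problem of a syntactic subclass is solvable in `FP` once the presenting problem is.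
[FGHS 2022, §3.1.1] [cite: FearnleyGoldbergHollenderSavani2022, §3.1.1] -/
theorem TFNP.solvableInFP_of_mem_closureOf {X R : SearchProblem} (hR : R ∈ TFNP.closureOf X)
    (hX : X.SolvableInFP) : R.SolvableInFP :=
  SearchProblem.SolvableInFP.of_manyOneReducible hR.2 hX

/-! ### `P = NP` collapses `TFNP` into `FP` -/

namespace SearchProblem

/-- **If `NP ⊆ P` then every polynomially balanced search problem with `rel ∈ P` that is total
(on its valid instances) is solvable in polynomial time.** Proof: the tree's search-to-decision
theorem `exists_searchFn_of_NP_subset_P` (Arora–Barak, Thm. 2.18) applied to `R.rel ∈ P` with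
the balancing polynomial `p` gives `g ∈ FP` with `⟨x, g x⟩ ∈ R.rel` whenever `x` has a solution
of length `≤ p |x|`; by totality and balance every valid `x` has one. ("It is not known whether
FP = FNP; this question is equivalent to the P = NP question" — the easy direction, for total
problems.) [Megiddo–Papadimitriou 1991, p. 318; Papadimitriou 1994, §2 (FP ⊆ TFNP ⊆ FNP);
Arora–Barak 2009, Thm. 2.18] [cite: MegiddoPapadimitriou1991, p. 318] -/
theorem solvableInFP_of_NP_subset_P (hNP : Nondeterministic.NP ⊆ Classes.P) {R : SearchProblem}
    (hrel : R.rel ∈ Classes.P) (hb : R.IsPolyBalanced) (ht : R.IsTotal) : R.SolvableInFP := by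
  obtain ⟨p, hp⟩ := hb
  obtain ⟨g, hg, hspec⟩ := exists_searchFn_of_NP_subset_P hNP hrel p
  refine ⟨g, hg, fun x hx => ?_⟩
  obtain ⟨y, hy⟩ := ht x hx
  exact (hspec x ⟨y, hp x y hy, hy⟩).2

/-- `NP ⊆ P` ⟹ every `TFNP` problem is solvable in `FP`. [Megiddo–Papadimitriou 1991, p. 318]
[cite: MegiddoPapadimitriou1991, p. 318] -/
theorem solvableInFP_of_mem_TFNP (hNP : Nondeterministic.NP ⊆ Classes.P) {R : SearchProblem}
    (hR : R ∈ TFNP) : R.SolvableInFP :=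
  solvableInFP_of_NP_subset_P hNP hR.1.1 hR.1.2.2 hR.2

/-- Contrapositive, the shape the `PneNP` routes use: a total, polynomially balanced,
`P`-checkable search problem that NO polynomial-time function solves witnesses `NP ⊄ P`.
[Megiddo–Papadimitriou 1991, p. 318; Papadimitriou 1994, §2]
[cite: MegiddoPapadimitriou1991, p. 318] -/
theorem not_NP_subset_P_of_not_solvableInFP {R : SearchProblem} (hrel : R.rel ∈ Classes.P)
    (hb : R.IsPolyBalanced) (ht : R.IsTotal) (hX : ¬ R.SolvableInFP) :
    ¬ (Nondeterministic.NP ⊆ Classes.P) :=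
  fun hNP => hX (solvableInFP_of_NP_subset_P hNP hrel hb ht)

/-- … and hence `P ≠ NP` in the tree's classes (feed to `pneNP_shape_of_P_ne_NP` of
`CookBridges.lean` for Cook's statement). [Megiddo–Papadimitriou 1991, p. 318]
[cite: MegiddoPapadimitriou1991, p. 318] -/
theorem P_ne_NP_of_not_solvableInFP {R : SearchProblem} (hrel : R.rel ∈ Classes.P)
    (hb : R.IsPolyBalanced) (ht : R.IsTotal) (hX : ¬ R.SolvableInFP) :
    Classes.P ≠ Nondeterministic.NP :=
  fun h => not_NP_subset_P_of_not_solvableInFP hrel hb ht hX h.symm.subset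

end SearchProblem

/-- Bundled form: under `NP ⊆ P` every total NP search problem is solvable in `FP`.
[Megiddo–Papadimitriou 1991, p. 318] [cite: MegiddoPapadimitriou1991, p. 318] -/
theorem TotalSearchProblem.solvableInFP_of_NP_subset_P (T : TotalSearchProblem)
    (hNP : Nondeterministic.NP ⊆ Classes.P) : T.SolvableInFP :=
  SearchProblem.solvableInFP_of_NP_subset_P hNP T.rel_mem_P T.balanced T.total

end Literature.Computability.Complexity
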